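/-
B2b (LevelGradedCohnUmans, decidable (m,k) = (2,1) cell) — gen 17.
**The `(2,1)` verdict in one statement.**

VALUE = THEOREM / DECIDABLE VERDICT on one cell, NOT summit progress; the crux item
`SubgroupIdentityDesigns` is untouched and remains open.
Report: `run/shared/lean/b2b/levelgraded-cu/ORACLE-g17.md` §G17-3.
-/
import Mathlib
import Summits.MatrixMultiplication.MatrixMultiplication.Theorems.SubgroupIdentityDesigns.Negative.ThirtyOneResidual

/-!
# The `(2,1)` cell of `SubgroupIdentityDesigns`: the verdict

One quotable statement assembling gen 13–17: **`levelOne_witness_verdict`** — at ANY prime `p`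
and any `0 < ε ≤ 1`, a subgroup triple of `GL₂(𝔽_p)` with the TPP, a rank-`≤ 1` identity design
and the level-one budget inequality forces `p = 31` (`CellFive.cellTwoOne_empty_of_ne_31'`:
`p = 2, 3, 5` by hand, `7 ≤ p ≤ 43` by the parity law + Dickson sharp + the kernel-evaluated
order sieve, `p ≥ 47` by Dickson's theorem in Lean) AND, at `p = 31`, the single residual profile
of `ThirtyOneResidual.levelOne_witness_31_residual` (`E ∋ -1`, `|E| = 120`, projective image
`60`, `E` conjugate into no Cartan normaliser; `A`, `B` conjugate into the monomial group with
`(|A|, |S_A|; |B|, |S_B|) = (90, 3; 150, 5)` up to order) — the profile the gen-16 exhaustive census (kit `j126482`, 45 720 TPP triples, all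
certificate-killed) covers as DATA.  Closing that one profile in Lean is the only remaining
non-theorem point of the cell.
-/

set_option linter.dupNamespace false

noncomputable section

open scoped Classical
open Summit.MatrixMultiplication.MatrixMultiplication.Theorems.LieRankDesigns.Negative (GLm Mat budget)
open Literature.Barriers.MatrixMultiplication (SubgroupTPP)

namespace Summit.MatrixMultiplication.MatrixMultiplication.Theorems.SubgroupIdentityDesigns.Negative

section Verdict

variable {p : ℕ} [hp : Fact p.Prime]

/-- **The `(2,1)` verdict.**  A `(2,1)` witness (`0 < ε ≤ 1`) forces `p = 31` and the residual
profile: `E ∋ -1`, `|E| = 120`, projective image `60`, `E` conjugate into NO Cartan normaliser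
(neither `N(T_s)` nor any `N(C_n)`), and `A`, `B` conjugate into the monomial group with
`(|A|, |S_A|; |B|, |S_B|) = (90, 3; 150, 5)` up to order.  Decidable verdict on one cell — NOT
summit progress. -/
theorem levelOne_witness_verdict {ε : ℝ} (hε : 0 < ε) (hε1 : ε ≤ 1)
    {H₁ H₂ H₃ : Subgroup (GLm p 2)} (htpp : SubgroupTPP H₁ H₂ H₃)
    (hdesign : ∃ c : Mat p 2 → ℂ, (∀ M, 1 < M.rank → c M = 0) ∧
      (∑ M, c M * ZMod.stdAddChar (Matrix.trace (M * ((1 : GLm p 2) : Mat p 2)))) = 1 ∧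
      ∀ a ∈ H₁, ∀ b ∈ H₂, ∀ g ∈ H₃, a * b * g ≠ 1 →
        (∑ M, c M *
          ZMod.stdAddChar (Matrix.trace (M * ((a * b * g : GLm p 2) : Mat p 2)))) = 0)
    (hwit : budget p 2 1 (2 + ε) <
      ((Nat.card H₁ * Nat.card H₂ * Nat.card H₃ : ℕ) : ℝ) ^ ((2 + ε) / 3)) :
    p = 31 ∧ ∃ E A B : Subgroup (GLm p 2),
      ((E = H₁ ∧ A = H₂ ∧ B = H₃) ∨ (E = H₂ ∧ A = H₁ ∧ B = H₃) ∨ (E = H₃ ∧ A = H₁ ∧ B = H₂)) ∧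
      scalarHom p 2 (-1) ∈ E ∧ Nat.card E = 120 ∧
      Nat.card (E.map (QuotientGroup.mk' (scalarHom p 2).range)) = 60 ∧
      (∀ g : GLm p 2, ∃ x ∈ E, ¬ IsMonomial (g * x * g⁻¹)) ∧
      (∀ n : ZMod p, (∀ x : ZMod p, x * x ≠ n) →
        ∀ g : GLm p 2, ∃ x ∈ E, ¬ IsSingerNormal n (g * x * g⁻¹)) ∧
      (∃ g : GLm p 2, ∀ x ∈ A, IsMonomial (g * x * g⁻¹)) ∧
      (∃ g : GLm p 2, ∀ x ∈ B, IsMonomial (g * x * g⁻¹)) ∧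
      ((Nat.card A = 90 ∧ Nat.card (A.comap (scalarHom p 2)) = 3 ∧
          Nat.card B = 150 ∧ Nat.card (B.comap (scalarHom p 2)) = 5) ∨
        (Nat.card A = 150 ∧ Nat.card (A.comap (scalarHom p 2)) = 5 ∧
          Nat.card B = 90 ∧ Nat.card (B.comap (scalarHom p 2)) = 3)) := by
  obtain rfl := prime_eq_31_of_levelOne_witness hε hε1 htpp hdesign hwit
  obtain ⟨E, A, B, hperm, hmem, hE, himg, hAm, hBm, hnum⟩ :=
    levelOne_witness_31_residual hε hε1 htpp hdesign hwit
  -- the member conjugate into no Cartan normaliser is `E` (the other two are monomial-type)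
  have key : ∀ {H : Subgroup (GLm 31 2)}, (H = H₁ ∨ H = H₂ ∨ H = H₃) →
      (∀ g : GLm 31 2, ∃ x ∈ H, ¬ IsMonomial (g * x * g⁻¹)) → H = E := by
    intro H hH hnm
    have hHA : H ≠ A := by
      rintro rfl
      obtain ⟨g, hg⟩ := hAm
      obtain ⟨x, hx, hxm⟩ := hnm g
      exact hxm (hg x hx)
    have hHB : H ≠ B := by
      rintro rfl
      obtain ⟨g, hg⟩ := hBm
      obtain ⟨x, hx, hxm⟩ := hnm g
      exact hxm (hg x hx)
    rcases hperm with ⟨rfl, rfl, rfl⟩ | ⟨rfl, rfl, rfl⟩ | ⟨rfl, rfl, rfl⟩ <;>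
      rcases hH with rfl | rfl | rfl <;>
      first | rfl | exact absurd rfl hHA | exact absurd rfl hHB
  have hnm : ∀ g : GLm 31 2, ∃ x ∈ E, ¬ IsMonomial (g * x * g⁻¹) := by
    obtain ⟨n, hn⟩ := FiniteField.exists_nonsquare (F := ZMod 31) (by
      rw [ZMod.ringChar_zmod_n]; norm_num)
    obtain ⟨H, hH, hnm, -⟩ := exists_member_not_conj_cartan (by norm_num)
      (fun x hx => hn ⟨x, hx.symm⟩) hε hε1 htpp hdesign hwit
    exact key hH hnm ▸ hnm
  have hns : ∀ n : ZMod 31, (∀ x : ZMod 31, x * x ≠ n) →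
      ∀ g : GLm 31 2, ∃ x ∈ E, ¬ IsSingerNormal n (g * x * g⁻¹) := by
    intro n hn
    obtain ⟨H, hH, hnm', hns⟩ := exists_member_not_conj_cartan (by norm_num) hn hε hε1 htpp
      hdesign hwit
    exact key hH hnm' ▸ hns
  exact ⟨rfl, E, A, B, hperm, hmem, hE, himg, hnm, hns, hAm, hBm, hnum⟩

/-- **No `(2,1)` witness outside the residual profile**: contrapositive packaging — if at `p = 31`
no triple has the residual profile, the `(2,1)` cell is empty at every prime. -/
theorem cellTwoOne_empty_of_no_residual
    (hres : ∀ (E A B : Subgroup (GLm p 2)), scalarHom p 2 (-1) ∈ E → Nat.card E = 120 →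
      Nat.card (E.map (QuotientGroup.mk' (scalarHom p 2).range)) = 60 →
      (∀ g : GLm p 2, ∃ x ∈ E, ¬ IsMonomial (g * x * g⁻¹)) →
      (∀ n : ZMod p, (∀ x : ZMod p, x * x ≠ n) →
        ∀ g : GLm p 2, ∃ x ∈ E, ¬ IsSingerNormal n (g * x * g⁻¹)) →
      (∃ g : GLm p 2, ∀ x ∈ A, IsMonomial (g * x * g⁻¹)) →
      (∃ g : GLm p 2, ∀ x ∈ B, IsMonomial (g * x * g⁻¹)) →
      Nat.card A = 90 → Nat.card (A.comap (scalarHom p 2)) = 3 →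
      Nat.card B = 150 → Nat.card (B.comap (scalarHom p 2)) = 5 →
      ¬ (SubgroupTPP E A B ∨ SubgroupTPP A E B ∨ SubgroupTPP A B E ∨
         SubgroupTPP E B A ∨ SubgroupTPP B E A ∨ SubgroupTPP B A E))
    {ε : ℝ} (hε : 0 < ε) (hε1 : ε ≤ 1)
    {H₁ H₂ H₃ : Subgroup (GLm p 2)} (htpp : SubgroupTPP H₁ H₂ H₃)
    (hdesign : ∃ c : Mat p 2 → ℂ, (∀ M, 1 < M.rank → c M = 0) ∧
      (∑ M, c M * ZMod.stdAddChar (Matrix.trace (M * ((1 : GLm p 2) : Mat p 2)))) = 1 ∧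
      ∀ a ∈ H₁, ∀ b ∈ H₂, ∀ g ∈ H₃, a * b * g ≠ 1 →
        (∑ M, c M *
          ZMod.stdAddChar (Matrix.trace (M * ((a * b * g : GLm p 2) : Mat p 2)))) = 0) :
    ¬ budget p 2 1 (2 + ε) <
      ((Nat.card H₁ * Nat.card H₂ * Nat.card H₃ : ℕ) : ℝ) ^ ((2 + ε) / 3) := by
  intro hwit
  obtain ⟨-, E, A, B, hperm, hmem, hE, himg, hnm, hns, hAm, hBm, hnum⟩ :=
    levelOne_witness_verdict hε hε1 htpp hdesign hwit
  rcases hnum with ⟨hA, hzA, hB, hzB⟩ | ⟨hA, hzA, hB, hzB⟩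
  · have h := hres E A B hmem hE himg hnm hns hAm hBm hA hzA hB hzB
    rcases hperm with ⟨rfl, rfl, rfl⟩ | ⟨rfl, rfl, rfl⟩ | ⟨rfl, rfl, rfl⟩
    · exact h (Or.inl htpp)
    · exact h (Or.inr (Or.inl htpp))
    · exact h (Or.inr (Or.inr (Or.inl htpp)))
  · have h := hres E B A hmem hE himg hnm hns hBm hAm hB hzB hA hzA
    rcases hperm with ⟨rfl, rfl, rfl⟩ | ⟨rfl, rfl, rfl⟩ | ⟨rfl, rfl, rfl⟩
    · exact h (Or.inr (Or.inr (Or.inr (Or.inl htpp))))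
    · exact h (Or.inr (Or.inr (Or.inr (Or.inr (Or.inl htpp)))))
    · exact h (Or.inr (Or.inr (Or.inr (Or.inr (Or.inr htpp)))))

end Verdict

end Summit.MatrixMultiplication.MatrixMultiplication.Theorems.SubgroupIdentityDesigns.Negative

end
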